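import Summits.FinalStateConjecture.FinalStateConjecture.Theses.BartnikGapSettling
import Literature.Geometry.Lorentzian.TameGenericityDiagonal
import Literature.Geometry.Lorentzian.EventHorizon
import Summits.FinalStateConjecture.FinalStateConjecture.Theorems.TameCensorshipCollarMargin.Negative.TameCensorshipCollarMarginFalseOfExtremalJunkCollars

/-!
# Line `zdm-spinup-window` — checked skeleton for crux `TameCensorshipCollarMargin`
# (stmt-FinalStateConjecture-17329, route `BartnikGapSettling`)

planner-cruxplan-stmt-FinalStateConjecture-17329-zdm-spinup-window-0 (crux-plan, opening), 2026-08-17.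
Idea card `Cruxes/TameCensorshipCollarMargin/Ideas/zdm-spinup-window.md` (triage r1-1/2/3: pass ×3);
line card `Lines/zdm-spinup-window.md`.

## ELIGIBILITY (read first) — the filed text vs. the restated crux

The FILED decl `…Theses.BartnikGapSettling.TameCensorshipCollarMargin` (route rev 6, un-windowed
margin conjunct) is refuted modulo `ExtremalJunkCollars ∧ MGHDExists` by the LANDED Negative lemma
`Theorems.TameCensorshipCollarMargin.Negative.TameCensorshipCollarMargin_false_of_ExtremalJunkCollars`
(p146745; re-used in §6 below); every seat on this crux (registrar, rattack, leads 0/c1, triagers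
r1-1/2/3) recommends RESTATING it to the windowed order-2 form `TameCensorshipCollarMarginW`
(`VERDICT-lead0.md` §2). As the protocol fixes the crux decl, this skeleton concludes the filed decl
BY NAME (`TameCensorshipCollarMargin_of`, §5) exactly as the registered skeleton `Lines/birth.lean`
does — through the inherited transfer stub `stub_unwindowing` (verbatim `birth`'s registered
signature; believed FALSE mod `ExtremalJunkCollars`, isolated and named, §6
`stub_unwindowing_false_of`) — and it is therefore dead-on-arrival at that stub for the FILED text,
like `birth` (`Lines/birth-dead.md`). Its CONTENT is a line for the honest target: the three new
stubs Z1/R/G below discharge `birth`'s load-bearing stub `stub_windowedThirdLawAlongCensoredCurves`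
VERBATIM (`thirdLawAlongCensoredCurves_of`, §4, sorry-free) and, with tame weak cosmic censorship,
the restated crux VERBATIM (`TameCensorshipCollarMarginW_of_stubs`, §5, sorry-free). After the
restatement the skeleton is retargeted by ONE line (`TameCensorshipCollarMarginW_of_stubs stub₁ Z1 R G`),
dropping `stub_unwindowing`.

## The line (collar currency; the zdm lever is stub Z1)

The card's lever is the TWO-FLUX COMPETITION LAW for the extremality deficit `ε_J = M² − J` of a
horizon, `dε_J = k (2Mω − m) S dv` (`k = ω − mΩ_H`, `S ≥ 0`): the deficit decreases only through the
spin-up window `mΩ_H < ω < m/2M`, whose width is `∝ κ ∝ √ε_J`; external (incident) in-window flux is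
doubly suppressed (window width × grey-body factor `∝ k`) and obeys a Grönwall floor in the incident
ENERGY, so the only road from a positive deficit to extremality inside a quiescent era is the hole's
OWN zero-damped cavity (`ℓ = m ≥ 3` families are in-window: `0 < δ < m`, kit j023959, re-derived by
all three triagers), i.e. FROZEN-CAVITY EXCLUSION decides. The tree has no horizon `(M, J)(v)`, no
dynamical surface gravity and no QNM content, so the line is typed in the currency the crux itself
uses — late windowed `C²`-quiet thick collar charts — with horizon CUTS (`DataEmbedding.horizonCut`,
`futureEventHorizon`) anchoring collars to holes (answering the STAND-OFF objection, TRIAGE-r1-2 N1):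

* `QuiescentFrom 𝒟 m₀ ρ₀ δ K` — from `K` on, every point of `𝓗⁺` lies in the horizon cut of a
  `K`-late windowed `(2,δ)`-quiet collar ("the final perturbative era", triage sharpening (b));
* `GoodAncestryFrom 𝒟 m₀ ρ₀ θ δ K K₂` — every horizon point after `K₂` is in `J⁺` of the cut of a
  `K`-late `θ`-good (`|a| ≤ (1−θ)M`) `(2,δ)`-quiet collar ("a positive deficit at an epoch of the era");
* `GoodCoverFrom 𝒟 m₀ ρ₀ θ δ K K'` — after `K'`, every horizon point is in the cut of a `K`-late
  `θ`-good `(2,δ)`-quiet collar ("liminf of the deficit positive, and the hole settles", sharpening (a)).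

STUBS (5; the registry dedups the two inherited ones with `birth` by signature):
1. `stub_tameCensorship` (inherited, verbatim) — tame weak cosmic censorship. Open problem.
2. `stub_subextremalityPersists : SubextremalityPersists` — **Z1, THE LEVER (FrozenCavityExclusion
   in collar currency, ∀-statement, no genericity).** For all windows there is a COARSE quietness
   `δ⋆(m₀,ρ₀)` such that for every margin `θ` there are `θ'`, and a FINE `δ₁`, with: in every maximal
   development of admissible data with complete `𝓘⁺`, if from `K` on the horizon is `δ⋆`-quiescent and
   every late generator descends from a `K`-late `θ`-good `(2,δ₁)`-quiet epoch, then for every target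
   fineness `δ₂` the horizon is eventually covered by `θ'`-good `(2,δ₂)`-quiet collars. `∃ δ⋆` BEFORE
   `∀ θ` is the point: perturbations of size `δ⋆ ≫ √θ` (a late-loaded zero-damped cavity in the bad
   basin `E_Z ≳ √ε_J`) are allowed during the era — the caricature `ẋ = −cxy, ẏ = −c′xy` has an OPEN
   bad basin, so the stub is exactly the bet that leakage at `κ → 0` closes it nonlinearly; with
   `∃ δ⋆` moved after `∀ θ` it degrades to small-data asymptotic stability of sub-extremal Kerr
   exteriors with parameter tracking (believed; `SlowlyRotatingKerrFrontier`-hard).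
3. `stub_standOffLabelTransfer : StandOffLabelTransfer` — **R, the dictionary (∀).** A `θ'`-good fine
   cover of the late horizon forces ALL sufficiently late windowed fine-quiet collars — honest,
   hovering (stand-off), interior, far — to be `θ''`-good: curvature obstruction inside windows,
   quantitative local Kerr rigidity, label rigidity of overlapping quiet charts. M/L.
4. `stub_genericQuiescentGoodAncestry : GenericQuiescentGoodAncestry` — **G, the generic core, in the
   relative-kernel form of `birth` stub 2.** Along censored tame curves the curve can be re-chosen so
   that every member off `0` is censored AND each of its MGHDs is, window by window, eventually
   `δc`-quiescent with `θ`-good `δf`-fine ancestry for every `δc, δf > 0` (one `θ` per member and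
   window). Exceptional set = the extremal threshold: E2 (exactly extremal horizon after `v₀`,
   Kehle–Unger; escaped by the tail/K-flux seed of the sibling line `kflux-seeds-the-ratchet`) ∪ E3
   (area-deficient asymptotically extremal approach with perpetual tails / `𝔐_stable`, first-order
   census-side transversal — UNCLAIMED by any mechanism on file, TRIAGE-r1-2 N2 / r1-3 N2) ∪ holes that
   never settle. E1 (frozen cavities) is NOT here: it is Z1. No census residual: the statements are
   per horizon generator. Open problem (the generic third law's transversality), rank: hardest.
5. `stub_unwindowing` (inherited, verbatim) — windowed order-2 margin ⇒ filed un-windowed margin,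
   pointwise. Believed FALSE mod `ExtremalJunkCollars` (§6). To be DELETED by the restatement.

COMPOSITION (sorry-free): `windowedClause₂_of_pointwise` (G-clause + Z1 + R ⇒ the order-2 windowed
margin of one development: `δ⋆ ← Z1`, `θ ← G`, `(θ', δ₁) ← Z1 θ`, `(δ₂, θ'', δ') ← R θ'`,
`(K, K₂) ← G δ⋆ δ₁`, `K' ← Z1`, `K'' ← R`, answer `(1 − θ'', δ', K'')`);
`thirdLawAlongCensoredCurves_of : Z1 → R → G → <birth stub 2, verbatim>`;
`TameCensorshipCollarMarginW_of_stubs : stub₁ → Z1 → R → G → W` (`isTameChristodoulouGeneric_of_relative`);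
`crux_body_of_stubs : stub₁ → Z1 → R → G → stub₅ → <filed body>` (`.mono`);
`TameCensorshipCollarMargin_of : <route decl> := crux_body_of_stubs stub_…` (hypothesis-free, by name).

Disproof used: no `Cruxes/TameCensorshipCollarMargin/Disproof.lean` exists (payload path absent on
this hub; `ledger crux ls`). Honoured instead: the landed Negative lemma p146745 (imported; §6
`filed_false_of_ExtremalJunkCollars` is it, by name) — pinned on `stub_unwindowing`
(`stub_unwindowing_false_of`: one good windowed MGHD with junk refutes the stub's registered
signature); stubs 1–4 are windowed (label AND boost) and horizon-anchored, so neither the far junk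
family (labels `→ ∞`, empty horizon cut) nor the stand-off hover (empty cut) is an instance of any.
`ledger negatives --problem FinalStateConjecture`: stmt-10045 only (photon-sphere channels), unrelated.
-/

noncomputable section

-- D-0017: single-problem summit, `Summit.<S>.<S>.…` by design (cf. lakefile `weak.linter.dupNamespace`).
set_option linter.dupNamespace false
set_option linter.unusedVariables false

open Set Function
open scoped Manifold ContDiff Topology ENNReal

namespace Summit.FinalStateConjecture.FinalStateConjecture.Cruxes.TameCensorshipCollarMargin.ZdmSpinupWindow

open Literature.Geometry.Lorentzian

/-! ## §1 Vocabulary — collar currency, horizon-anchored -/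

/-- The boost size of a motion `mo = (Λ, c)`: `max ‖Λ‖ ‖Λ⁻¹‖` (inlined verbatim in the crux). -/
abbrev boostNorm (mo : lorentzGroup × E4) : ℝ :=
  max ‖((mo.1 : E4 ≃L[ℝ] E4) : E4 →L[ℝ] E4)‖ ‖((mo.1 : E4 ≃L[ℝ] E4).symm : E4 →L[ℝ] E4)‖

section Vocabulary

variable {X : Type} [TopologicalSpace X] [ChartedSpace E3 X]
  [IsManifold (𝓡 3) ((⊤ : ℕ∞) : WithTop ℕ∞) X] [ConnectedSpace X] {D : InitialDataSet (𝓡 3) X}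

/-- **Windowed, bounded-boost thick collar chart** `(M₁, a₁, mo₁, B₁, Φ₁)` of `𝒟` for the windows
`m₀, ρ₀`, tolerance `(k, δ)` and cut-off `K`: exactly the curried hypotheses of the windowed margin
clause C‴ as ONE conjunction — label `m₀ ≤ M₁ ≤ m₀⁻¹`, boost `boostNorm mo₁ ≤ ρ₀`, `|a₁| ≤ M₁`, `B₁` the
boosted Kerr star background of label `(M₁, a₁)` and motion `mo₁`, `Φ₁` smooth on and an open
embedding of the collar layer `{−1 < t* < 1, r < 3M₁ + 1}`, `δ`-close in `Cᵏ` to Kerr on the thick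
slab `{t* = 0, M₁ < r ≤ 3M₁}`, slab image disjoint from `J⁻(K)`. (Same text as
`Cruxes/GenericCensorshipCollarMargin/Lines/deficit_ratchet.lean` §1; used here at `k = 2` only.) -/
def IsWindowedCollarChart (𝒟 : VacuumCauchyDevelopment D) (m₀ ρ₀ : ℝ) (k : ℕ) (δ : ℝ≥0∞)
    (K : Set 𝒟.carrier) (M₁ a₁ : ℝ) (mo₁ : lorentzGroup × E4) (B₁ : ModelBackground)
    (Φ₁ : B₁.domain → 𝒟.carrier) : Prop :=
  m₀ ≤ M₁ ∧ M₁ ≤ m₀⁻¹ ∧ boostNorm mo₁ ≤ ρ₀ ∧ |a₁| ≤ M₁ ∧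
    B₁ = starBackground mo₁.1 mo₁.2 M₁ a₁ (fun x => Kerr.radius a₁ (poincareInv mo₁.1 mo₁.2 x)) ∧
    ContMDiffOn 𝓘(ℝ, E4) (𝓡 4) ((⊤ : ℕ∞) : WithTop ℕ∞) Φ₁
      {x | -1 < B₁.time x.1 ∧ B₁.time x.1 < 1 ∧ B₁.radius x.1 < 3 * M₁ + 1} ∧
    Topology.IsOpenEmbedding
      ({x | -1 < B₁.time x.1 ∧ B₁.time x.1 < 1 ∧ B₁.radius x.1 < 3 * M₁ + 1}.restrict Φ₁) ∧
    𝒟.toSpacetime.truncDeviationCk B₁ Φ₁ k (3 * M₁) 0 ≤ δ ∧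
    Disjoint (Φ₁ '' B₁.truncTimeSlab (3 * M₁) 0) (𝒟.metric.causalPast 𝒟.timeOrientation K)

/-- The label mass of a windowed chart is positive when the window is. -/
theorem IsWindowedCollarChart.mass_pos {𝒟 : VacuumCauchyDevelopment D} {m₀ ρ₀ : ℝ} {k : ℕ}
    {δ : ℝ≥0∞} {K : Set 𝒟.carrier} {M₁ a₁ : ℝ} {mo₁ : lorentzGroup × E4} {B₁ : ModelBackground}
    {Φ₁ : B₁.domain → 𝒟.carrier} (h : IsWindowedCollarChart 𝒟 m₀ ρ₀ k δ K M₁ a₁ mo₁ B₁ Φ₁)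
    (hm₀ : 0 < m₀) : 0 < M₁ :=
  hm₀.trans_le h.1

/-- The **thick collar slab** of a chart: the image of `{t* = 0, M₁ < r ≤ 3M₁}`. -/
def collarSlab (𝒟 : VacuumCauchyDevelopment D) (M₁ : ℝ) (B₁ : ModelBackground)
    (Φ₁ : B₁.domain → 𝒟.carrier) : Set 𝒟.carrier :=
  Φ₁ '' B₁.truncTimeSlab (3 * M₁) 0

variable (𝒟 : VacuumCauchyDevelopment D)

/-- **`δ`-quiescence of the horizon from `K` on** (the "final perturbative era", typed): every point
of the future event horizon `𝓗⁺ = ∂J⁻(𝓘⁺)` outside `J⁻(K)` lies in the horizon CUT of some `K`-late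
windowed `(2, δ)`-quiet thick collar. Anchoring by cuts excludes stand-off (hovering) charts, whose
cut is empty, and a large pulse crossing the near zone (no quiet chart covers the horizon while it
passes — Kehle–Unger's finite-time extremal gluing is thereby outside every quiescent era,
TRIAGE-r1-1 (b) / r1-3 (ii)). -/
def QuiescentFrom [𝒟.metric.HasLeviCivita] (m₀ ρ₀ : ℝ) (δ : ℝ≥0∞) (K : Set 𝒟.carrier) : Prop :=
  ∀ p ∈ 𝒟.futureEventHorizon, p ∉ 𝒟.metric.causalPast 𝒟.timeOrientation K →
    ∃ (M₁ a₁ : ℝ) (mo₁ : lorentzGroup × E4) (B₁ : ModelBackground) (Φ₁ : B₁.domain → 𝒟.carrier),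
      IsWindowedCollarChart 𝒟 m₀ ρ₀ 2 δ K M₁ a₁ mo₁ B₁ Φ₁ ∧
        p ∈ 𝒟.horizonCut (collarSlab 𝒟 M₁ B₁ Φ₁)

/-- **`θ`-good `(2,δ)`-quiet ancestry of the horizon after `K₂`, by `K`-late epochs**: every horizon
point outside `J⁻(K₂)` lies in the causal future of the horizon cut of some `K`-late windowed
`(2, δ)`-quiet collar of `θ`-good label, `|a₁| ≤ (1 − θ) M₁` ("a positive extremality deficit at an
epoch INSIDE the era": the epoch is itself `K`-late, so no merger or pulse separates it from its
descendants when the horizon is quiescent from `K`). -/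
def GoodAncestryFrom [𝒟.metric.HasLeviCivita] (m₀ ρ₀ θ : ℝ) (δ : ℝ≥0∞) (K K₂ : Set 𝒟.carrier) :
    Prop :=
  ∀ p ∈ 𝒟.futureEventHorizon, p ∉ 𝒟.metric.causalPast 𝒟.timeOrientation K₂ →
    ∃ (M₁ a₁ : ℝ) (mo₁ : lorentzGroup × E4) (B₁ : ModelBackground) (Φ₁ : B₁.domain → 𝒟.carrier),
      IsWindowedCollarChart 𝒟 m₀ ρ₀ 2 δ K M₁ a₁ mo₁ B₁ Φ₁ ∧ |a₁| ≤ (1 - θ) * M₁ ∧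
        p ∈ 𝒟.metric.causalFuture 𝒟.timeOrientation (𝒟.horizonCut (collarSlab 𝒟 M₁ B₁ Φ₁))

/-- **`θ`-good `(2,δ)`-quiet cover of the horizon after `K'`, by `K`-late collars**: every horizon
point outside `J⁻(K')` lies in the horizon cut of some `K`-late windowed `(2, δ)`-quiet collar of
`θ`-good label (liminf of the deficit positive AND the hole settles to fineness `δ`). -/
def GoodCoverFrom [𝒟.metric.HasLeviCivita] (m₀ ρ₀ θ : ℝ) (δ : ℝ≥0∞) (K K' : Set 𝒟.carrier) :
    Prop :=
  ∀ p ∈ 𝒟.futureEventHorizon, p ∉ 𝒟.metric.causalPast 𝒟.timeOrientation K' →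
    ∃ (M₁ a₁ : ℝ) (mo₁ : lorentzGroup × E4) (B₁ : ModelBackground) (Φ₁ : B₁.domain → 𝒟.carrier),
      IsWindowedCollarChart 𝒟 m₀ ρ₀ 2 δ K M₁ a₁ mo₁ B₁ Φ₁ ∧ |a₁| ≤ (1 - θ) * M₁ ∧
        p ∈ 𝒟.horizonCut (collarSlab 𝒟 M₁ B₁ Φ₁)

/-- **The order-2 windowed bounded-boost collar-margin clause of ONE development** (the second
conjunct of the restated crux C‴₂, over the vocabulary; `windowedClause₂_iff` uncurries it to the
verbatim text). -/
def WindowedClause₂ : Prop :=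
  ∀ m₀ ρ₀ : ℝ, 0 < m₀ → 0 < ρ₀ → ∃ (χ₁ : ℝ) (δ₁ : ℝ≥0∞) (K₁ : Set 𝒟.carrier),
    χ₁ < 1 ∧ 0 < δ₁ ∧ IsCompact K₁ ∧
    ∀ (M₁ a₁ : ℝ) (mo₁ : lorentzGroup × E4) (B₁ : ModelBackground) (Φ₁ : B₁.domain → 𝒟.carrier),
      IsWindowedCollarChart 𝒟 m₀ ρ₀ 2 δ₁ K₁ M₁ a₁ mo₁ B₁ Φ₁ → |a₁| ≤ χ₁ * M₁

/-- `WindowedClause₂ 𝒟` IS the windowed order-2 margin clause of the restated crux for `𝒟`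
(uncurrying only; the right-hand side is that clause VERBATIM). -/
theorem windowedClause₂_iff : WindowedClause₂ 𝒟 ↔ (∀ m₀ ρ₀ : ℝ, 0 < m₀ → 0 < ρ₀ → ∃ (χ₁ : ℝ) (δ₁ : ENNReal) (K₁ : Set 𝒟.carrier), χ₁ < 1 ∧ 0 < δ₁ ∧ IsCompact K₁ ∧ ∀ (M₁ a₁ : ℝ) (mo₁ : lorentzGroup × E4) (B₁ : ModelBackground) (Φ₁ : B₁.domain → 𝒟.carrier), m₀ ≤ M₁ → M₁ ≤ m₀⁻¹ → max ‖((mo₁.1 : E4 ≃L[ℝ] E4) : E4 →L[ℝ] E4)‖ ‖((mo₁.1 : E4 ≃L[ℝ] E4).symm : E4 →L[ℝ] E4)‖ ≤ ρ₀ → |a₁| ≤ M₁ → B₁ = starBackground mo₁.1 mo₁.2 M₁ a₁ (fun x => Kerr.radius a₁ (poincareInv mo₁.1 mo₁.2 x)) → ContMDiffOn 𝓘(ℝ, E4) (𝓡 4) ((⊤ : ℕ∞) : WithTop ℕ∞) Φ₁ {x | -1 < B₁.time x.1 ∧ B₁.time x.1 < 1 ∧ B₁.radius x.1 < 3 * M₁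 + 1} → Topology.IsOpenEmbedding ({x | -1 < B₁.time x.1 ∧ B₁.time x.1 < 1 ∧ B₁.radius x.1 < 3 * M₁ + 1}.restrict Φ₁) → 𝒟.toSpacetime.truncDeviationCk B₁ Φ₁ 2 (3 * M₁) 0 ≤ δ₁ → Disjoint (Φ₁ '' B₁.truncTimeSlab (3 * M₁) 0) (𝒟.metric.causalPast 𝒟.timeOrientation K₁) → |a₁| ≤ χ₁ * M₁) := by
  constructor
  · intro h m₀ ρ₀ hm₀ hρ₀
    obtain ⟨χ₁, δ₁, K₁, hχ, hδ, hK, H⟩ := h m₀ ρ₀ hm₀ hρ₀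
    exact ⟨χ₁, δ₁, K₁, hχ, hδ, hK, fun M₁ a₁ mo₁ B₁ Φ₁ h1 h2 h3 h4 h5 h6 h7 h8 h9 =>
      H M₁ a₁ mo₁ B₁ Φ₁ ⟨h1, h2, h3, h4, h5, h6, h7, h8, h9⟩⟩
  · intro h m₀ ρ₀ hm₀ hρ₀
    obtain ⟨χ₁, δ₁, K₁, hχ, hδ, hK, H⟩ := h m₀ ρ₀ hm₀ hρ₀
    exact ⟨χ₁, δ₁, K₁, hχ, hδ, hK, fun M₁ a₁ mo₁ B₁ Φ₁ hc =>
      H M₁ a₁ mo₁ B₁ Φ₁ hc.1 hc.2.1 hc.2.2.1 hc.2.2.2.1 hc.2.2.2.2.1 hc.2.2.2.2.2.1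
        hc.2.2.2.2.2.2.1 hc.2.2.2.2.2.2.2.1 hc.2.2.2.2.2.2.2.2⟩

variable {𝒟}

/-- A good cover is in particular a good ancestry by the same collars (`cut ⊆ J⁺(cut)`): the
conclusion shape of Z1 feeds its own hypothesis shape one level finer — the fixed-point structure of
"settled and sub-extremal". -/
theorem GoodCoverFrom.goodAncestryFrom [𝒟.metric.HasLeviCivita] {m₀ ρ₀ θ : ℝ} {δ : ℝ≥0∞}
    {K K' : Set 𝒟.carrier} (h : GoodCoverFrom 𝒟 m₀ ρ₀ θ δ K K') :
    GoodAncestryFrom 𝒟 m₀ ρ₀ θ δ K K' := by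
  intro p hp hpK
  obtain ⟨M₁, a₁, mo₁, B₁, Φ₁, hC, hθ, hcut⟩ := h p hp hpK
  exact ⟨M₁, a₁, mo₁, B₁, Φ₁, hC, hθ,
    LorentzianMetric.subset_causalFuture 𝒟.metric 𝒟.timeOrientation _ hcut⟩

/-- A good cover at margin `θ` is a good cover at every smaller margin (positive window). -/
theorem GoodCoverFrom.anti [𝒟.metric.HasLeviCivita] {m₀ ρ₀ θ θ' : ℝ} {δ : ℝ≥0∞}
    {K K' : Set 𝒟.carrier} (h : GoodCoverFrom 𝒟 m₀ ρ₀ θ δ K K') (hm₀ : 0 < m₀) (hθ : θ' ≤ θ) :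
    GoodCoverFrom 𝒟 m₀ ρ₀ θ' δ K K' := by
  intro p hp hpK
  obtain ⟨M₁, a₁, mo₁, B₁, Φ₁, hC, hgood, hcut⟩ := h p hp hpK
  refine ⟨M₁, a₁, mo₁, B₁, Φ₁, hC, hgood.trans ?_, hcut⟩
  have hM : 0 < M₁ := hC.mass_pos hm₀
  nlinarith

/-- Later cut-offs: a good cover after `K'` is a good cover after any `K'' ⊇ K'` (`J⁻` monotone). -/
theorem GoodCoverFrom.mono_right [𝒟.metric.HasLeviCivita] {m₀ ρ₀ θ : ℝ} {δ : ℝ≥0∞}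
    {K K' K'' : Set 𝒟.carrier} (h : GoodCoverFrom 𝒟 m₀ ρ₀ θ δ K K') (hK : K' ⊆ K'') :
    GoodCoverFrom 𝒟 m₀ ρ₀ θ δ K K'' := by
  intro p hp hpK
  refine h p hp fun hp' => hpK ?_
  exact LorentzianMetric.causalFuture_mono hK hp'

end Vocabulary

/-! ## §2 The three new statements of the line -/

/-- **Z1 — `SubextremalityPersists`: the zdm lever, FROZEN-CAVITY EXCLUSION in collar currency
(∀-statement over censored admissible MGHDs; no genericity; XL).** For all windows `0 < m₀, 0 < ρ₀`
there is a COARSE quietness `δ⋆ > 0` such that for every margin `0 < θ < 1` there are a margin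
`0 < θ' < 1` and a FINE quietness `δ₁ > 0` with the following property, uniformly over every
connected Hausdorff second-countable `3`-manifold `X`, every admissible datum, every maximal vacuum
Cauchy development `𝒟` with complete `𝓘⁺`, every target fineness `δ₂ > 0` and compact `K, K₂`:
IF the horizon of `𝒟` is `δ⋆`-quiescent from `K` on (`QuiescentFrom`) AND every horizon point after
`K₂` descends from a `K`-late `θ`-good `(2, δ₁)`-quiet epoch (`GoodAncestryFrom`), THEN after some
compact `K'` every horizon point lies in the cut of a `K`-late `θ'`-good `(2, δ₂)`-quiet collar
(`GoodCoverFrom`) — no hole spins up to extremality inside a quiescent era from a certified positive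
deficit, and it settles. MECHANISM (card §Lever, triage-confirmed): along a quiescent horizon the
deficit `ε_J = M² − J` obeys `dε_J = k(2Mω − m)S dv ≥ 0` off the spin-up window `mΩ_H < ω < m/2M`
(width `∝ κ ∝ √ε_J`); in-window INCIDENT flux is floored (`dε_J ≥ −C κ² F_inc`, grey-body `∝ k`,
Grönwall in the incident energy), so only STORED near-zone energy with non-integrable leakage can
drive `ε_J → 0`: the hole's own zero-damped `ℓ = m ≥ 3` ringing (`0 < δ < m`: Hod arXiv:0811.3806,
Yang–Zimmerman–Zenginoğlu–Zhang–Berti–Chen arXiv:1307.8086 §3.3, kit j023959). The quantifier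
`∃ δ⋆` BEFORE `∀ θ` admits cavities of energy `δ⋆² ≫ √θ` loaded late in the era (the open bad basin
`E_Z ≳ 0.76 √ε_J M/θ_H` of the adiabatic caricature `ẋ = −cxy, ẏ = −c′xy`, conserved `y − (c′/c)x`),
so the stub IS the bet that a near-extremal cavity cannot stay spectrally pure as `κ → 0` (second-order
`m′ = 0` envelope flux is out-of-window and un-suppressed; CGZ/GZ arXiv:1711.00855 leakage; "no
dynamics in the extremal throat"). With `∃ δ⋆` moved after `∀ θ` (so `δ⋆ ≪ √θ`) the stub is
small-data asymptotic stability of sub-extremal Kerr exteriors from clean collar data with parameter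
tracking (`|Δa| ≲ C(θ)δ`), believed but beyond every nonlinear theorem for `|a|` not small
(`Literature.Barriers.FinalStateConjecture.SlowlyRotatingKerrFrontier`, conceded). WHY IT MIGHT FAIL:
the bad basin may survive nonlinearly (`1/v` collective ZDM leakage gives `∫ y = ∞`, polynomial
approach to extremality) — then an OPEN set of admissible data is frozen-cavity exceptional and the
RESTATED crux (and the summit's generic `Kerr.IsSubextremal` clause) fail: informative either way.
Refutable by ONE development (conditionally constructible: the caricature's bad configuration
`a₀/M ∈ [0.99, 0.999]`, `ℓ = m = 3` packet, `E_Z ≳ √(1 − a₀/M) M`). -/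
def SubextremalityPersists : Prop :=
  ∀ m₀ ρ₀ : ℝ, 0 < m₀ → 0 < ρ₀ → ∃ δs : ℝ≥0∞, 0 < δs ∧
    ∀ θ : ℝ, 0 < θ → θ < 1 → ∃ (θ' : ℝ) (δ₁ : ℝ≥0∞), 0 < θ' ∧ θ' < 1 ∧ 0 < δ₁ ∧
      ∀ (X : Type) [TopologicalSpace X] [ChartedSpace E3 X]
        [IsManifold (𝓡 3) ((⊤ : ℕ∞) : WithTop ℕ∞) X] [T2Space X] [SecondCountableTopology X]
        [ConnectedSpace X], ∀ D ∈ admissibleVacuumData X, ∀ 𝒟 : VacuumCauchyDevelopment D,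
        𝒟.IsMaximal → ∀ [𝒟.metric.HasLeviCivita],
        Summit.FinalStateConjecture.HasCompleteNullInfinity 𝒟.toCauchyDevelopment →
        ∀ (δ₂ : ℝ≥0∞) (K K₂ : Set 𝒟.carrier), 0 < δ₂ → IsCompact K → IsCompact K₂ →
          QuiescentFrom 𝒟 m₀ ρ₀ δs K → GoodAncestryFrom 𝒟 m₀ ρ₀ θ δ₁ K K₂ →
          ∃ K' : Set 𝒟.carrier, IsCompact K' ∧ GoodCoverFrom 𝒟 m₀ ρ₀ θ' δ₂ K K'

/-- **R — `StandOffLabelTransfer`: the dictionary (∀-statement; M/L).** For all windows and every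
margin `0 < θ' < 1` there are a cover fineness `δ₂ > 0`, a margin `0 < θ'' < 1` and a tolerance
`δ' > 0` such that in every maximal development of admissible data with complete `𝓘⁺`: if after `K'`
every horizon point lies in the cut of a `K`-late `θ'`-good `(2, δ₂)`-quiet collar (`GoodCoverFrom`),
then beyond some compact `K''` EVERY windowed bounded-boost `(2, δ')`-quiet thick collar chart — honest
(cut non-empty), hovering / stand-off (cut empty; TRIAGE-r1-2 N1: nothing anchors a chart to `𝓗⁺`),
interior (black-hole region), or far — has `|a₁| ≤ (1 − θ'') M₁`. CONTENT: (i) inside a label window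
and a boost window, `δ'`-`C²`-closeness of the chart components to boosted Kerr–Schild forces the
Kretschmann scalar on the slab to be `≥ c(m₀) > 0`, so no windowed quiet collar lives in the far /
flat region (`Cruxes/GenericCensorshipCollarMargin/RESTATEMENT.md` §3); (ii) quantitative LOCAL KERR
RIGIDITY: an open region `C²`-close to a thick exterior collar of `Kerr(M₁, a₁)` is `C²`-close to no
other Kerr region with a window-separated label — in particular not to the interior `r < r₊` of a hole
of comparable mass (Mars–Simon / Ionescu–Klainerman local characterisation, `r` and `(M, a)` are
curvature invariants); (iii) LABEL RIGIDITY of overlapping quiet charts + finite-time Cauchy stability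
off the quiet covers: a hovering chart in the near zone of a hole whose horizon is finely covered by
`θ'`-good charts reads its label up to `O(δ)` (`spin_ratio_lock`-type algebra, p123576). WHY IT MIGHT
FAIL: (ii) deep inside the black-hole region the geometry is unknown (a windowed thick `C²`-quiet
Kerr-EXTERIOR-like region near a Cauchy horizon / singular boundary is implausible but excluded by no
theorem); (iii) needs the covers' slabs to control the whole late near zone between them (gaps near
`𝓗⁺` and beyond `3M`). Vacuous at hairy asymptotically extremal holes (no fine honest cover exists
there: Aretakis / Gralla–Zimmerman growth at `𝓗⁺`), as it must be. -/
def StandOffLabelTransfer : Prop :=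
  ∀ m₀ ρ₀ θ' : ℝ, 0 < m₀ → 0 < ρ₀ → 0 < θ' → θ' < 1 →
    ∃ (δ₂ : ℝ≥0∞) (θ'' : ℝ) (δ' : ℝ≥0∞), 0 < δ₂ ∧ 0 < θ'' ∧ θ'' < 1 ∧ 0 < δ' ∧
      ∀ (X : Type) [TopologicalSpace X] [ChartedSpace E3 X]
        [IsManifold (𝓡 3) ((⊤ : ℕ∞) : WithTop ℕ∞) X] [T2Space X] [SecondCountableTopology X]
        [ConnectedSpace X], ∀ D ∈ admissibleVacuumData X, ∀ 𝒟 : VacuumCauchyDevelopment D,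
        𝒟.IsMaximal → ∀ [𝒟.metric.HasLeviCivita],
        Summit.FinalStateConjecture.HasCompleteNullInfinity 𝒟.toCauchyDevelopment →
        ∀ (K K' : Set 𝒟.carrier), IsCompact K → IsCompact K' →
          GoodCoverFrom 𝒟 m₀ ρ₀ θ' δ₂ K K' →
          ∃ K'' : Set 𝒟.carrier, IsCompact K'' ∧
            ∀ (M₁ a₁ : ℝ) (mo₁ : lorentzGroup × E4) (B₁ : ModelBackground)
              (Φ₁ : B₁.domain → 𝒟.carrier),
              IsWindowedCollarChart 𝒟 m₀ ρ₀ 2 δ' K'' M₁ a₁ mo₁ B₁ Φ₁ → |a₁| ≤ (1 - θ'') * M₁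

/-- **G — `GenericQuiescentGoodAncestry`: the generic core, in the relative-kernel shape of `birth`
stub 2 (open problem; rank: hardest).** For every end `e` of `X` and every tame one-parameter family
`F` of admissible data on `e` whose members off `0` are censored (`F` immersed at `0` and injective,
or constant), there is a tame family `F'` on the SAME end with `F' 0 = F 0`, injective, immersed at
`0`, admissible, whose members off `0` are censored AND whose MGHDs are, for all windows, EVENTUALLY
QUIESCENT WITH GOOD ANCESTRY: some margin `0 < θ < 1` (per member and window) such that for every
coarse `δc > 0` and fine `δf > 0` there are compact `K, K₂` with the horizon `δc`-quiescent from `K`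
and `θ`-good `(2, δf)`-quiet `K`-late ancestry after `K₂`. This is `deficit-ratchet`'s
`GenericTerminalEpochs` (10809 line, dead at its bounded-feeding clause) with BOUNDED FEEDING REPLACED
BY QUIESCENCE — an observable hypothesis — the dynamics having moved to Z1, and the census gone
(per-generator statements). EXCEPTIONAL SET inside censored data = the extremal threshold: E2 — the
horizon is exactly extremal Kerr after `v₀` (Kehle–Unger arXiv:2211.15742 Cor. 1, arXiv:2402.10190;
"itself an infinite-codimension phenomenon", §1.4.5): every quiet cover has an extremal label, no
`θ > 0`; escaped along the sibling line's K-flux / tail seed (`Ideas/kflux-seeds-the-ratchet.md`;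
Angelopoulos–Aretakis–Gajic arXiv:1612.01566, Ma–Zhang arXiv:2111.04489 for generic non-vanishing
tails), after which Z1 takes over; E3 — area-deficient asymptotically extremal approach with perpetual
tails, the conjectured generic threshold member `𝔐_stable` (AKU arXiv:2410.16234 Thm 1, Dafermos
GRG 57 (2025) Conj. 6.1/6.2): non-quiescent at `C²` by horizon instability, transversal FIRST order
and census-side (dispersion on one side) — NO mechanism on file supplies it (TRIAGE-r1-2 N2, r1-3
N2): this is where the stub is the open generic third law; holes that never settle to `C²`-quietness
(sub-extremal Kerr stability failure; conjecturally none). Frozen cavities (E1) are NOT exceptional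
here — they have fine `θ`-good epochs before loading and are Z1's burden. WHY IT MIGHT FAIL: the
codimension of the extremal threshold in vacuum is open (KU §1.4.5); the re-chosen curve must stay
CENSORED (genericity is not `∧`-closed along curves — the robust kernel `RobustlyEscapable.and` of
`Theorems/RobustClausewiseGenericityAssembly.lean` + `isTameChristodoulouGeneric_of_robust`
(p136312/p136319) is the alternative door: state quiescent-good-ancestry ROBUSTLY and take
`CensorshipRobust` (stmt-10131) by name); one-sided / Cantor accumulation of thresholds along a curve. -/
def GenericQuiescentGoodAncestry : Prop :=
  ∀ (X : Type) [TopologicalSpace X] [ChartedSpace E3 X]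
    [IsManifold (𝓡 3) ((⊤ : ℕ∞) : WithTop ℕ∞) X] [T2Space X] [SecondCountableTopology X]
    [ConnectedSpace X], ∀ (e : AFEnd X) (F : EuclideanSpace ℝ (Fin 1) → InitialDataSet (𝓡 3) X),
    InitialDataSet.IsTameDataFamily e 1 F →
    ((InitialDataSet.IsImmersedAtZero 1 F ∧ Function.Injective F) ∨ ∀ c, F c = F 0) →
    (∀ c, F c ∈ admissibleVacuumData X) →
    (∀ c ≠ 0, ∀ 𝒟 : VacuumCauchyDevelopment (F c), 𝒟.IsMaximal →
      Summit.FinalStateConjecture.HasCompleteNullInfinity 𝒟.toCauchyDevelopment) →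
    ∃ F' : EuclideanSpace ℝ (Fin 1) → InitialDataSet (𝓡 3) X,
      InitialDataSet.IsTameDataFamily e 1 F' ∧ F' 0 = F 0 ∧ Function.Injective F' ∧
      InitialDataSet.IsImmersedAtZero 1 F' ∧ (∀ c, F' c ∈ admissibleVacuumData X) ∧
      ∀ c ≠ 0, ∀ 𝒟 : VacuumCauchyDevelopment (F' c), 𝒟.IsMaximal →
        Summit.FinalStateConjecture.HasCompleteNullInfinity 𝒟.toCauchyDevelopment ∧
        ∀ [𝒟.metric.HasLeviCivita], ∀ m₀ ρ₀ : ℝ, 0 < m₀ → 0 < ρ₀ →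
          ∃ θ : ℝ, 0 < θ ∧ θ < 1 ∧ ∀ (δc δf : ℝ≥0∞), 0 < δc → 0 < δf →
            ∃ K K₂ : Set 𝒟.carrier, IsCompact K ∧ IsCompact K₂ ∧
              QuiescentFrom 𝒟 m₀ ρ₀ δc K ∧ GoodAncestryFrom 𝒟 m₀ ρ₀ θ δf K K₂

/-! ## §3 The registered stubs -/

/-- **Stub 1 (inherited from `birth`, verbatim) — tame weak cosmic censorship.** Tame-generically in
the admissible class every MGHD has complete `𝓘⁺` (sojourn form). Christodoulou, CQG 16 (1999) A23;
Dafermos–Rodnianski arXiv:0811.0354 §2.6.2. Follows by `IsTameChristodoulouGeneric.mono` from the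
sibling item `PhaseMixingCapture.WeakCosmicCensorshipTame`. Open problem. -/
theorem stub_tameCensorship : ∀ (X : Type) [TopologicalSpace X] [ChartedSpace E3 X] [IsManifold (𝓡 3) ((⊤ : ℕ∞) : WithTop ℕ∞) X] [T2Space X] [SecondCountableTopology X] [ConnectedSpace X], InitialDataSet.IsTameChristodoulouGeneric (admissibleVacuumData X) (fun D => ∀ 𝒟 : VacuumCauchyDevelopment D, 𝒟.IsMaximal → Summit.FinalStateConjecture.HasCompleteNullInfinity 𝒟.toCauchyDevelopment) 1 := by
  sorry

/-- **Stub 2 — Z1, the lever** (see `SubextremalityPersists`). -/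
theorem stub_subextremalityPersists : SubextremalityPersists := by
  sorry

/-- **Stub 3 — R, the dictionary** (see `StandOffLabelTransfer`). -/
theorem stub_standOffLabelTransfer : StandOffLabelTransfer := by
  sorry

/-- **Stub 4 — G, the generic core** (see `GenericQuiescentGoodAncestry`). -/
theorem stub_genericQuiescentGoodAncestry : GenericQuiescentGoodAncestry := by
  sorry

/-- **Stub 5 (inherited from `birth`, verbatim) — unwindowing: THE INHERITED MISSTATEMENT, ISOLATED.**
For an MGHD of an admissible datum with complete `𝓘⁺`, the windowed order-2 margin C‴₂ implies the
FILED un-windowed clause. **Believed FALSE modulo `ExtremalJunkCollars`** together with one good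
windowed MGHD (`stub_unwindowing_false_of`, §6); it disappears under the recommended restatement
(`TameCensorshipCollarMarginW_of_stubs` does not use it). Registered only because the protocol fixes
the crux decl; nobody should work it. -/
theorem stub_unwindowing : ∀ (X : Type) [TopologicalSpace X] [ChartedSpace E3 X] [IsManifold (𝓡 3) ((⊤ : ℕ∞) : WithTop ℕ∞) X] [T2Space X] [SecondCountableTopology X] [ConnectedSpace X], ∀ D ∈ admissibleVacuumData X, ∀ 𝒟 : VacuumCauchyDevelopment D, 𝒟.IsMaximal → Summit.FinalStateConjecture.HasCompleteNullInfinity 𝒟.toCauchyDevelopment → (∀ m₀ ρ₀ : ℝ, 0 < m₀ → 0 < ρ₀ → ∃ (χ₁ : ℝ) (δ₁ : ENNReal) (K₁ : Set 𝒟.carrier), χ₁ < 1 ∧ 0 < δ₁ ∧ IsCompact K₁ ∧ ∀ (M₁ a₁ : ℝ) (mo₁ : lorentzGroup × E4) (B₁ : ModelBackground) (Φ₁ : B₁.domain → 𝒟.carrier), m₀ ≤ M₁ → M₁ ≤ m₀⁻¹ → max ‖((mo₁.1 : E4 ≃L[ℝ] E4) : E4 →L[ℝ] E4)‖ ‖((mo₁.1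 : E4 ≃L[ℝ] E4).symm : E4 →L[ℝ] E4)‖ ≤ ρ₀ → |a₁| ≤ M₁ → B₁ = starBackground mo₁.1 mo₁.2 M₁ a₁ (fun x => Kerr.radius a₁ (poincareInv mo₁.1 mo₁.2 x)) → ContMDiffOn 𝓘(ℝ, E4) (𝓡 4) ((⊤ : ℕ∞) : WithTop ℕ∞) Φ₁ {x | -1 < B₁.time x.1 ∧ B₁.time x.1 < 1 ∧ B₁.radius x.1 < 3 * M₁ + 1} → Topology.IsOpenEmbedding ({x | -1 < B₁.time x.1 ∧ B₁.time x.1 < 1 ∧ B₁.radius x.1 < 3 * M₁ + 1}.restrict Φ₁) → 𝒟.toSpacetime.truncDeviationCk B₁ Φ₁ 2 (3 * M₁) 0 ≤ δ₁ → Disjoint (Φ₁ '' B₁.truncTimeSlab (3 * M₁) 0) (𝒟.metric.causalPast 𝒟.timeOrientation K₁) → |a₁| ≤ χ₁ * M₁) → (∃ (χ₁ : ℝ) (k₁ : ℕ) (δ₁ : ENNReal) (K₁ : Set 𝒟.carrier), χ₁ < 1 ∧ 0 < δ₁ ∧ IsCompact K₁ ∧ ∀ (M₁ a₁ : ℝ)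 (mo₁ : lorentzGroup × E4) (B₁ : ModelBackground) (Φ₁ : B₁.domain → 𝒟.carrier), 0 < M₁ → |a₁| ≤ M₁ → B₁ = starBackground mo₁.1 mo₁.2 M₁ a₁ (fun x => Kerr.radius a₁ (poincareInv mo₁.1 mo₁.2 x)) → ContMDiffOn 𝓘(ℝ, E4) (𝓡 4) ((⊤ : ℕ∞) : WithTop ℕ∞) Φ₁ {x | -1 < B₁.time x.1 ∧ B₁.time x.1 < 1 ∧ B₁.radius x.1 < 3 * M₁ + 1} → Topology.IsOpenEmbedding ({x | -1 < B₁.time x.1 ∧ B₁.time x.1 < 1 ∧ B₁.radius x.1 < 3 * M₁ + 1}.restrict Φ₁) → 𝒟.toSpacetime.truncDeviationCk B₁ Φ₁ k₁ (3 * M₁) 0 ≤ δ₁ → Disjoint (Φ₁ '' B₁.truncTimeSlab (3 * M₁) 0) (𝒟.metric.causalPast 𝒟.timeOrientation K₁) → |a₁| ≤ χ₁ * M₁) := by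
  sorry

/-! ## §4 Composition, pointwise: one development, then `birth`'s load-bearing stub verbatim -/

section Composition

variable {X : Type} [TopologicalSpace X] [ChartedSpace E3 X]
  [IsManifold (𝓡 3) ((⊤ : ℕ∞) : WithTop ℕ∞) X] [T2Space X] [SecondCountableTopology X]
  [ConnectedSpace X]

/-- **Pointwise kernel.** For ONE maximal development of an admissible datum with complete `𝓘⁺` whose
horizon is eventually quiescent with good ancestry (the member clause of G), Z1 and R give the windowed
order-2 margin: `δ⋆ ← Z1 (m₀, ρ₀)`, `θ ← G`, `(θ', δ₁) ← Z1 θ`, `(δ₂, θ'', δ') ← R θ'`,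
`(K, K₂) ← G (δ⋆, δ₁)`, `K' ← Z1` (good fine cover), `K'' ← R`; answer `(1 − θ'', δ', K'')`. -/
theorem windowedClause₂_of_pointwise (hZ : SubextremalityPersists) (hR : StandOffLabelTransfer)
    {D : InitialDataSet (𝓡 3) X} (hD : D ∈ admissibleVacuumData X)
    (𝒟 : VacuumCauchyDevelopment D) (hmax : 𝒟.IsMaximal) [𝒟.metric.HasLeviCivita]
    (hscri : Summit.FinalStateConjecture.HasCompleteNullInfinity 𝒟.toCauchyDevelopment)
    (hG : ∀ m₀ ρ₀ : ℝ, 0 < m₀ → 0 < ρ₀ →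
      ∃ θ : ℝ, 0 < θ ∧ θ < 1 ∧ ∀ (δc δf : ℝ≥0∞), 0 < δc → 0 < δf →
        ∃ K K₂ : Set 𝒟.carrier, IsCompact K ∧ IsCompact K₂ ∧
          QuiescentFrom 𝒟 m₀ ρ₀ δc K ∧ GoodAncestryFrom 𝒟 m₀ ρ₀ θ δf K K₂) :
    WindowedClause₂ 𝒟 := by
  intro m₀ ρ₀ hm₀ hρ₀
  obtain ⟨δs, hδs, HZ⟩ := hZ m₀ ρ₀ hm₀ hρ₀
  obtain ⟨θ, hθ, hθ1, HG⟩ := hG m₀ ρ₀ hm₀ hρ₀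
  obtain ⟨θ', δ₁, hθ', hθ'1, hδ₁, HZ'⟩ := HZ θ hθ hθ1
  obtain ⟨δ₂, θ'', δ', hδ₂, hθ'', hθ''1, hδ', HR⟩ := hR m₀ ρ₀ θ' hm₀ hρ₀ hθ' hθ'1
  obtain ⟨K, K₂, hK, hK₂, hq, ha⟩ := HG δs δ₁ hδs hδ₁
  obtain ⟨K', hK', hcov⟩ := HZ' X D hD 𝒟 hmax hscri δ₂ K K₂ hδ₂ hK hK₂ hq ha
  obtain ⟨K'', hK'', H⟩ := HR X D hD 𝒟 hmax hscri K K' hK hK' hcov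
  exact ⟨1 - θ'', δ', K'', by linarith, hδ', hK'', fun M₁ a₁ mo₁ B₁ Φ₁ hC => H M₁ a₁ mo₁ B₁ Φ₁ hC⟩

/-- **The line discharges `birth`'s load-bearing stub.** `Z1 → R → G →` the registered signature of
`Birth.stub_windowedThirdLawAlongCensoredCurves`, VERBATIM (the collar third law along censored tame
curves, windowed, order 2): take the re-chosen curve from G and run the pointwise kernel on every MGHD
of every member off `0` (at THE Levi-Civita connection, `PseudoRiemannianMetric.hasLeviCivita`). -/
theorem thirdLawAlongCensoredCurves_of (hZ : SubextremalityPersists) (hR : StandOffLabelTransfer)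
    (hG : GenericQuiescentGoodAncestry) : ∀ (X : Type) [TopologicalSpace X] [ChartedSpace E3 X] [IsManifold (𝓡 3) ((⊤ : ℕ∞) : WithTop ℕ∞) X] [T2Space X] [SecondCountableTopology X] [ConnectedSpace X], ∀ (e : AFEnd X) (F : EuclideanSpace ℝ (Fin 1) → InitialDataSet (𝓡 3) X), InitialDataSet.IsTameDataFamily e 1 F → ((InitialDataSet.IsImmersedAtZero 1 F ∧ Function.Injective F) ∨ ∀ c, F c = F 0) → (∀ c, F c ∈ admissibleVacuumData X) → (∀ c ≠ 0, ∀ 𝒟 : VacuumCauchyDevelopment (F c), 𝒟.IsMaximal → Summit.FinalStateConjecture.HasCompleteNullInfinity 𝒟.toCauchyDevelopment) → ∃ F' : EuclideanSpace ℝ (Fin 1) → InitialDataSet (𝓡 3) X, InitialDataSet.IsTameDataFamily e 1 F' ∧ F' 0 = F 0 ∧ Function.Injective F' ∧ InitialDataSet.IsImmersedAtZero 1 F' ∧ (∀ c, F' c ∈ admissibleVacuumData X) ∧ ∀ c ≠ 0, ∀ 𝒟 : VacuumCauchyDevelopment (F' c), 𝒟.IsMaximal → Summit.FinalStateConjecture.HasCompleteNullInfinity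 𝒟.toCauchyDevelopment ∧ (∀ m₀ ρ₀ : ℝ, 0 < m₀ → 0 < ρ₀ → ∃ (χ₁ : ℝ) (δ₁ : ENNReal) (K₁ : Set 𝒟.carrier), χ₁ < 1 ∧ 0 < δ₁ ∧ IsCompact K₁ ∧ ∀ (M₁ a₁ : ℝ) (mo₁ : lorentzGroup × E4) (B₁ : ModelBackground) (Φ₁ : B₁.domain → 𝒟.carrier), m₀ ≤ M₁ → M₁ ≤ m₀⁻¹ → max ‖((mo₁.1 : E4 ≃L[ℝ] E4) : E4 →L[ℝ] E4)‖ ‖((mo₁.1 : E4 ≃L[ℝ] E4).symm : E4 →L[ℝ] E4)‖ ≤ ρ₀ → |a₁| ≤ M₁ → B₁ = starBackground mo₁.1 mo₁.2 M₁ a₁ (fun x => Kerr.radius a₁ (poincareInv mo₁.1 mo₁.2 x)) → ContMDiffOn 𝓘(ℝ, E4) (𝓡 4) ((⊤ : ℕ∞) : WithTop ℕ∞) Φ₁ {x | -1 < B₁.time x.1 ∧ B₁.time x.1 < 1 ∧ B₁.radius x.1 < 3 * M₁ + 1} → Topology.IsOpenEmbedding ({x | -1 < B₁.time x.1 ∧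 B₁.time x.1 < 1 ∧ B₁.radius x.1 < 3 * M₁ + 1}.restrict Φ₁) → 𝒟.toSpacetime.truncDeviationCk B₁ Φ₁ 2 (3 * M₁) 0 ≤ δ₁ → Disjoint (Φ₁ '' B₁.truncTimeSlab (3 * M₁) 0) (𝒟.metric.causalPast 𝒟.timeOrientation K₁) → |a₁| ≤ χ₁ * M₁) := by
  intro X _ _ _ _ _ _ e F hF hdich h𝓓 hQ
  obtain ⟨F', hF', h0, hinj, himm, hadm, hgood⟩ := hG X e F hF hdich h𝓓 hQ
  refine ⟨F', hF', h0, hinj, himm, hadm, fun c hc 𝒟 hmax => ?_⟩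
  obtain ⟨hscri, hrest⟩ := hgood c hc 𝒟 hmax
  refine ⟨hscri, ?_⟩
  haveI : 𝒟.metric.HasLeviCivita := 𝒟.metric.toPseudoRiemannianMetric.hasLeviCivita
  exact (windowedClause₂_iff 𝒟).1 (windowedClause₂_of_pointwise hZ hR (hadm c) 𝒟 hmax hscri hrest)

end Composition

/-! ## §5 The restated crux W (sorry-free from stubs 1–4) and the filed decl BY NAME (stubs 1–5) -/

/-- **Restated crux C‴₂ (tame) — `TameCensorshipCollarMarginW`, verbatim the text of
`Cruxes/TameCensorshipCollarMargin/VERDICT_lead0.lean` §2 / `VERDICT-lead0.md` §2** (the filed text with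
the margin conjunct WINDOWED — label `m₀ ≤ M₁ ≤ m₀⁻¹` and boost `max ‖Λ‖ ‖Λ⁻¹‖ ≤ ρ₀` before
`(χ₁, δ₁, K₁)` — and at order `2`). Recorded here so that the line's honest target is kernel-checked
in the same file; nothing is filed (D-0014: the planner restates). -/
def TameCensorshipCollarMarginW : Prop :=
  ∀ (X : Type) [TopologicalSpace X] [ChartedSpace E3 X] [IsManifold (𝓡 3) ((⊤ : ℕ∞) : WithTop ℕ∞) X] [T2Space X] [SecondCountableTopology X] [ConnectedSpace X], InitialDataSet.IsTameChristodoulouGeneric (admissibleVacuumData X) (fun D => ∀ 𝒟 : VacuumCauchyDevelopment D, 𝒟.IsMaximal → Summit.FinalStateConjecture.HasCompleteNullInfinity 𝒟.toCauchyDevelopment ∧ (∀ m₀ ρ₀ : ℝ, 0 < m₀ → 0 < ρ₀ → ∃ (χ₁ : ℝ) (δ₁ : ENNReal) (K₁ : Set 𝒟.carrier), χ₁ < 1 ∧ 0 < δ₁ ∧ IsCompact K₁ ∧ ∀ (M₁ a₁ : ℝ) (mo₁ : lorentzGroup × E4) (B₁ : ModelBackground) (Φ₁ : B₁.domain → 𝒟.carrier),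 m₀ ≤ M₁ → M₁ ≤ m₀⁻¹ → max ‖((mo₁.1 : E4 ≃L[ℝ] E4) : E4 →L[ℝ] E4)‖ ‖((mo₁.1 : E4 ≃L[ℝ] E4).symm : E4 →L[ℝ] E4)‖ ≤ ρ₀ → |a₁| ≤ M₁ → B₁ = starBackground mo₁.1 mo₁.2 M₁ a₁ (fun x => Kerr.radius a₁ (poincareInv mo₁.1 mo₁.2 x)) → ContMDiffOn 𝓘(ℝ, E4) (𝓡 4) ((⊤ : ℕ∞) : WithTop ℕ∞) Φ₁ {x | -1 < B₁.time x.1 ∧ B₁.time x.1 < 1 ∧ B₁.radius x.1 < 3 * M₁ + 1} → Topology.IsOpenEmbedding ({x | -1 < B₁.time x.1 ∧ B₁.time x.1 < 1 ∧ B₁.radius x.1 < 3 * M₁ + 1}.restrict Φ₁) → 𝒟.toSpacetime.truncDeviationCk B₁ Φ₁ 2 (3 * M₁) 0 ≤ δ₁ → Disjoint (Φ₁ '' B₁.truncTimeSlab (3 * M₁) 0) (𝒟.metric.causalPast 𝒟.timeOrientation K₁) → |a₁| ≤ χ₁ * M₁)) 1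

/-- **Stubs 1–4 imply the restated crux, verbatim** (no `stub_unwindowing`): composition of tame
genericities along curves, `InitialDataSet.isTameChristodoulouGeneric_of_relative` with `Q :=`
censorship and `P :=` censorship `∧` C‴₂ (constant curves are tame on the sole strongly flat end of an
admissible datum, `exists_isSoleEnd_of_mem_admissibleVacuumData`), the handed-back curves from
`thirdLawAlongCensoredCurves_of`. After the restatement THIS is the skeleton theorem. -/
theorem TameCensorshipCollarMarginW_of_stubs
    (h₁ : ∀ (X : Type) [TopologicalSpace X] [ChartedSpace E3 X] [IsManifold (𝓡 3) ((⊤ : ℕ∞) : WithTop ℕ∞) X] [T2Space X] [SecondCountableTopology X] [ConnectedSpace X], InitialDataSet.IsTameChristodoulouGeneric (admissibleVacuumData X) (fun D => ∀ 𝒟 : VacuumCauchyDevelopment D, 𝒟.IsMaximal → Summit.FinalStateConjecture.HasCompleteNullInfinity 𝒟.toCauchyDevelopment) 1)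
    (hZ : SubextremalityPersists) (hR : StandOffLabelTransfer) (hG : GenericQuiescentGoodAncestry) :
    TameCensorshipCollarMarginW := by
  intro X _ _ _ _ _ _
  exact InitialDataSet.isTameChristodoulouGeneric_of_relative
    (Q := fun D => ∀ 𝒟 : VacuumCauchyDevelopment D, 𝒟.IsMaximal →
      Summit.FinalStateConjecture.HasCompleteNullInfinity 𝒟.toCauchyDevelopment)
    (fun d hd => exists_isSoleEnd_of_mem_admissibleVacuumData hd) (h₁ X)
    (fun e F hF hdich h𝓓 hQ => thirdLawAlongCensoredCurves_of hZ hR hG X e F hF hdich h𝓓 hQ)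

/-- **The five stub statements imply the BODY of the filed crux** (restated crux from stubs 1–4,
then `IsTameChristodoulouGeneric.mono` along the pointwise unwindowing of stub 5 — the dead edge). -/
theorem crux_body_of_stubs
    (h₁ : ∀ (X : Type) [TopologicalSpace X] [ChartedSpace E3 X] [IsManifold (𝓡 3) ((⊤ : ℕ∞) : WithTop ℕ∞) X] [T2Space X] [SecondCountableTopology X] [ConnectedSpace X], InitialDataSet.IsTameChristodoulouGeneric (admissibleVacuumData X) (fun D => ∀ 𝒟 : VacuumCauchyDevelopment D, 𝒟.IsMaximal → Summit.FinalStateConjecture.HasCompleteNullInfinity 𝒟.toCauchyDevelopment) 1)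
    (hZ : SubextremalityPersists) (hR : StandOffLabelTransfer) (hG : GenericQuiescentGoodAncestry)
    (h₅ : ∀ (X : Type) [TopologicalSpace X] [ChartedSpace E3 X] [IsManifold (𝓡 3) ((⊤ : ℕ∞) : WithTop ℕ∞) X] [T2Space X] [SecondCountableTopology X] [ConnectedSpace X], ∀ D ∈ admissibleVacuumData X, ∀ 𝒟 : VacuumCauchyDevelopment D, 𝒟.IsMaximal → Summit.FinalStateConjecture.HasCompleteNullInfinity 𝒟.toCauchyDevelopment → (∀ m₀ ρ₀ : ℝ, 0 < m₀ → 0 < ρ₀ → ∃ (χ₁ : ℝ) (δ₁ : ENNReal) (K₁ : Set 𝒟.carrier), χ₁ < 1 ∧ 0 < δ₁ ∧ IsCompact K₁ ∧ ∀ (M₁ a₁ : ℝ) (mo₁ : lorentzGroup × E4) (B₁ : ModelBackground) (Φ₁ : B₁.domain → 𝒟.carrier), m₀ ≤ M₁ → M₁ ≤ m₀⁻¹ → max ‖((mo₁.1 : E4 ≃L[ℝ] E4) : E4 →L[ℝ] E4)‖ ‖((mo₁.1 : E4 ≃L[ℝ] E4).symm : E4 →L[ℝ] E4)‖ ≤ ρ₀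 → |a₁| ≤ M₁ → B₁ = starBackground mo₁.1 mo₁.2 M₁ a₁ (fun x => Kerr.radius a₁ (poincareInv mo₁.1 mo₁.2 x)) → ContMDiffOn 𝓘(ℝ, E4) (𝓡 4) ((⊤ : ℕ∞) : WithTop ℕ∞) Φ₁ {x | -1 < B₁.time x.1 ∧ B₁.time x.1 < 1 ∧ B₁.radius x.1 < 3 * M₁ + 1} → Topology.IsOpenEmbedding ({x | -1 < B₁.time x.1 ∧ B₁.time x.1 < 1 ∧ B₁.radius x.1 < 3 * M₁ + 1}.restrict Φ₁) → 𝒟.toSpacetime.truncDeviationCk B₁ Φ₁ 2 (3 * M₁) 0 ≤ δ₁ → Disjoint (Φ₁ '' B₁.truncTimeSlab (3 * M₁) 0) (𝒟.metric.causalPast 𝒟.timeOrientation K₁) → |a₁| ≤ χ₁ * M₁) → (∃ (χ₁ : ℝ) (k₁ : ℕ) (δ₁ : ENNReal) (K₁ : Set 𝒟.carrier), χ₁ < 1 ∧ 0 < δ₁ ∧ IsCompact K₁ ∧ ∀ (M₁ a₁ : ℝ) (mo₁ : lorentzGroup × E4) (B₁ : ModelBackground) (Φ₁ : B₁.domain →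 𝒟.carrier), 0 < M₁ → |a₁| ≤ M₁ → B₁ = starBackground mo₁.1 mo₁.2 M₁ a₁ (fun x => Kerr.radius a₁ (poincareInv mo₁.1 mo₁.2 x)) → ContMDiffOn 𝓘(ℝ, E4) (𝓡 4) ((⊤ : ℕ∞) : WithTop ℕ∞) Φ₁ {x | -1 < B₁.time x.1 ∧ B₁.time x.1 < 1 ∧ B₁.radius x.1 < 3 * M₁ + 1} → Topology.IsOpenEmbedding ({x | -1 < B₁.time x.1 ∧ B₁.time x.1 < 1 ∧ B₁.radius x.1 < 3 * M₁ + 1}.restrict Φ₁) → 𝒟.toSpacetime.truncDeviationCk B₁ Φ₁ k₁ (3 * M₁) 0 ≤ δ₁ → Disjoint (Φ₁ '' B₁.truncTimeSlab (3 * M₁) 0) (𝒟.metric.causalPast 𝒟.timeOrientation K₁) → |a₁| ≤ χ₁ * M₁)) :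
    ∀ (X : Type) [TopologicalSpace X] [ChartedSpace E3 X] [IsManifold (𝓡 3) ((⊤ : ℕ∞) : WithTop ℕ∞) X] [T2Space X] [SecondCountableTopology X] [ConnectedSpace X], InitialDataSet.IsTameChristodoulouGeneric (admissibleVacuumData X) (fun D => ∀ 𝒟 : VacuumCauchyDevelopment D, 𝒟.IsMaximal → Summit.FinalStateConjecture.HasCompleteNullInfinity 𝒟.toCauchyDevelopment ∧ (∃ (χ₁ : ℝ) (k₁ : ℕ) (δ₁ : ENNReal) (K₁ : Set 𝒟.carrier), χ₁ < 1 ∧ 0 < δ₁ ∧ IsCompact K₁ ∧ ∀ (M₁ a₁ : ℝ) (mo₁ : lorentzGroup × E4) (B₁ : ModelBackground) (Φ₁ : B₁.domain → 𝒟.carrier), 0 < M₁ → |a₁| ≤ M₁ → B₁ = starBackground mo₁.1 mo₁.2 M₁ a₁ (fun x => Kerr.radius a₁ (poincareInv mo₁.1 mo₁.2 x)) → ContMDiffOn 𝓘(ℝ, E4) (𝓡 4) ((⊤ : ℕ∞) : WithTop ℕ∞) Φ₁ {x | -1 < B₁.time x.1 ∧ B₁.time x.1 < 1 ∧ B₁.radius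 x.1 < 3 * M₁ + 1} → Topology.IsOpenEmbedding ({x | -1 < B₁.time x.1 ∧ B₁.time x.1 < 1 ∧ B₁.radius x.1 < 3 * M₁ + 1}.restrict Φ₁) → 𝒟.toSpacetime.truncDeviationCk B₁ Φ₁ k₁ (3 * M₁) 0 ≤ δ₁ → Disjoint (Φ₁ '' B₁.truncTimeSlab (3 * M₁) 0) (𝒟.metric.causalPast 𝒟.timeOrientation K₁) → |a₁| ≤ χ₁ * M₁)) 1 := by
  intro X _ _ _ _ _ _
  refine (TameCensorshipCollarMarginW_of_stubs h₁ hZ hR hG X).mono ?_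
  intro D hD hP 𝒟 hmax
  obtain ⟨hCNI, hW⟩ := hP 𝒟 hmax
  exact ⟨hCNI, h₅ X D hD 𝒟 hmax hCNI hW⟩

/-- **THE SKELETON THEOREM: `TameCensorshipCollarMargin` (the route decl, BY NAME) from the five
registered stubs** — hypothesis-free, its term sorry-free, the only `sorry`s of the file being the
five `stub_*` it is applied to; the type is literally the route decl, which `δ`-unfolds to the
conclusion of `crux_body_of_stubs`. -/
theorem TameCensorshipCollarMargin_of :
    Summit.FinalStateConjecture.FinalStateConjecture.Theses.BartnikGapSettling.TameCensorshipCollarMargin :=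
  crux_body_of_stubs stub_tameCensorship stub_subextremalityPersists stub_standOffLabelTransfer
    stub_genericQuiescentGoodAncestry stub_unwindowing

/-! ## §6 Disproof used — the landed Negative lemma, and where it bites (stub 5 only) -/

open Summit.FinalStateConjecture.FinalStateConjecture.Theorems.GenericCensorshipCollarMargin.Negative
  (ExtremalJunkCollars not_collarMarginClause_of_junk)

/-- **The filed target is refuted modulo `ExtremalJunkCollars ∧ MGHDExists`** — this is the LANDED
lemma p146745, by name (imported), recorded so the skeleton's scratch check carries it. -/
theorem filed_false_of_ExtremalJunkCollars :
    ExtremalJunkCollars →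
    Summit.FinalStateConjecture.FinalStateConjecture.Theses.BartnikGapSettling.MGHDExists →
    ¬ Summit.FinalStateConjecture.FinalStateConjecture.Theses.BartnikGapSettling.TameCensorshipCollarMargin :=
  Summit.FinalStateConjecture.FinalStateConjecture.Theorems.TameCensorshipCollarMargin.Negative.TameCensorshipCollarMargin_false_of_ExtremalJunkCollars

/-- **Where it bites: `stub_unwindowing` only.** ONE admissible maximal development with complete
`𝓘⁺`, the windowed order-2 margin, and extremal-label junk collars at every tolerance refutes the
registered signature of stub 5 (apply it, then `not_collarMarginClause_of_junk`, p103863). Expected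
instance: the Minkowski MGHD of `trivialData` (windowed margin vacuous by the curvature obstruction,
junk by `ExtremalJunkCollars`); same statement as `LeadVerdict.stub_unwindowing_false_of`. Stubs 1–4
are windowed AND horizon-anchored: the junk family (labels `→ ∞`, empty cut) meets none of them. -/
theorem stub_unwindowing_false_of
    (X : Type) [TopologicalSpace X] [ChartedSpace E3 X]
    [IsManifold (𝓡 3) ((⊤ : ℕ∞) : WithTop ℕ∞) X] [T2Space X] [SecondCountableTopology X]
    [ConnectedSpace X]
    (D : InitialDataSet (𝓡 3) X) (hD : D ∈ admissibleVacuumData X)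
    (𝒟 : VacuumCauchyDevelopment D) (hmax : 𝒟.IsMaximal)
    (hCNI : Summit.FinalStateConjecture.HasCompleteNullInfinity 𝒟.toCauchyDevelopment)
    (hW : (∀ m₀ ρ₀ : ℝ, 0 < m₀ → 0 < ρ₀ → ∃ (χ₁ : ℝ) (δ₁ : ENNReal) (K₁ : Set 𝒟.carrier), χ₁ < 1 ∧ 0 < δ₁ ∧ IsCompact K₁ ∧ ∀ (M₁ a₁ : ℝ) (mo₁ : lorentzGroup × E4) (B₁ : ModelBackground) (Φ₁ : B₁.domain → 𝒟.carrier), m₀ ≤ M₁ → M₁ ≤ m₀⁻¹ → max ‖((mo₁.1 : E4 ≃L[ℝ] E4) : E4 →L[ℝ] E4)‖ ‖((mo₁.1 : E4 ≃L[ℝ] E4).symm : E4 →L[ℝ] E4)‖ ≤ ρ₀ → |a₁| ≤ M₁ → B₁ = starBackground mo₁.1 mo₁.2 M₁ a₁ (fun x => Kerr.radius a₁ (poincareInv mo₁.1 mo₁.2 x)) → ContMDiffOn 𝓘(ℝ, E4) (𝓡 4) ((⊤ : ℕ∞) : WithTop ℕ∞) Φ₁ {x | -1 < B₁.time x.1 ∧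 B₁.time x.1 < 1 ∧ B₁.radius x.1 < 3 * M₁ + 1} → Topology.IsOpenEmbedding ({x | -1 < B₁.time x.1 ∧ B₁.time x.1 < 1 ∧ B₁.radius x.1 < 3 * M₁ + 1}.restrict Φ₁) → 𝒟.toSpacetime.truncDeviationCk B₁ Φ₁ 2 (3 * M₁) 0 ≤ δ₁ → Disjoint (Φ₁ '' B₁.truncTimeSlab (3 * M₁) 0) (𝒟.metric.causalPast 𝒟.timeOrientation K₁) → |a₁| ≤ χ₁ * M₁))
    (hJ : ∀ (k₁ : ℕ) (δ₁ : ℝ≥0∞) (K₁ : Set 𝒟.carrier), 0 < δ₁ → IsCompact K₁ →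
        ∃ (M₁ : ℝ) (mo₁ : lorentzGroup × E4) (B₁ : ModelBackground)
          (Φ₁ : B₁.domain → 𝒟.carrier),
          0 < M₁ ∧
          B₁ = starBackground mo₁.1 mo₁.2 M₁ M₁
            (fun x => Kerr.radius M₁ (poincareInv mo₁.1 mo₁.2 x)) ∧
          ContMDiffOn 𝓘(ℝ, E4) (𝓡 4) ((⊤ : ℕ∞) : WithTop ℕ∞) Φ₁
            {x | -1 < B₁.time x.1 ∧ B₁.time x.1 < 1 ∧ B₁.radius x.1 < 3 * M₁ + 1} ∧
          Topology.IsOpenEmbedding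
            ({x | -1 < B₁.time x.1 ∧ B₁.time x.1 < 1 ∧ B₁.radius x.1 < 3 * M₁ + 1}.restrict Φ₁) ∧
          𝒟.toSpacetime.truncDeviationCk B₁ Φ₁ k₁ (3 * M₁) 0 ≤ δ₁ ∧
          Disjoint (Φ₁ '' B₁.truncTimeSlab (3 * M₁) 0)
            (𝒟.metric.causalPast 𝒟.timeOrientation K₁)) :
    ¬ (∀ (X : Type) [TopologicalSpace X] [ChartedSpace E3 X] [IsManifold (𝓡 3) ((⊤ : ℕ∞) : WithTop ℕ∞) X] [T2Space X] [SecondCountableTopology X] [ConnectedSpace X], ∀ D ∈ admissibleVacuumData X, ∀ 𝒟 : VacuumCauchyDevelopment D, 𝒟.IsMaximal → Summit.FinalStateConjecture.HasCompleteNullInfinity 𝒟.toCauchyDevelopment → (∀ m₀ ρ₀ : ℝ, 0 < m₀ → 0 < ρ₀ → ∃ (χ₁ : ℝ) (δ₁ : ENNReal) (K₁ : Set 𝒟.carrier), χ₁ < 1 ∧ 0 < δ₁ ∧ IsCompact K₁ ∧ ∀ (M₁ a₁ : ℝ) (mo₁ : lorentzGroup × E4) (B₁ : ModelBackground) (Φ₁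 : B₁.domain → 𝒟.carrier), m₀ ≤ M₁ → M₁ ≤ m₀⁻¹ → max ‖((mo₁.1 : E4 ≃L[ℝ] E4) : E4 →L[ℝ] E4)‖ ‖((mo₁.1 : E4 ≃L[ℝ] E4).symm : E4 →L[ℝ] E4)‖ ≤ ρ₀ → |a₁| ≤ M₁ → B₁ = starBackground mo₁.1 mo₁.2 M₁ a₁ (fun x => Kerr.radius a₁ (poincareInv mo₁.1 mo₁.2 x)) → ContMDiffOn 𝓘(ℝ, E4) (𝓡 4) ((⊤ : ℕ∞) : WithTop ℕ∞) Φ₁ {x | -1 < B₁.time x.1 ∧ B₁.time x.1 < 1 ∧ B₁.radius x.1 < 3 * M₁ + 1} → Topology.IsOpenEmbedding ({x | -1 < B₁.time x.1 ∧ B₁.time x.1 < 1 ∧ B₁.radius x.1 < 3 * M₁ + 1}.restrict Φ₁) → 𝒟.toSpacetime.truncDeviationCk B₁ Φ₁ 2 (3 * M₁) 0 ≤ δ₁ → Disjoint (Φ₁ '' B₁.truncTimeSlab (3 * M₁) 0) (𝒟.metric.causalPast 𝒟.timeOrientation K₁) → |a₁| ≤ χ₁ * M₁) → (∃ (χ₁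 : ℝ) (k₁ : ℕ) (δ₁ : ENNReal) (K₁ : Set 𝒟.carrier), χ₁ < 1 ∧ 0 < δ₁ ∧ IsCompact K₁ ∧ ∀ (M₁ a₁ : ℝ) (mo₁ : lorentzGroup × E4) (B₁ : ModelBackground) (Φ₁ : B₁.domain → 𝒟.carrier), 0 < M₁ → |a₁| ≤ M₁ → B₁ = starBackground mo₁.1 mo₁.2 M₁ a₁ (fun x => Kerr.radius a₁ (poincareInv mo₁.1 mo₁.2 x)) → ContMDiffOn 𝓘(ℝ, E4) (𝓡 4) ((⊤ : ℕ∞) : WithTop ℕ∞) Φ₁ {x | -1 < B₁.time x.1 ∧ B₁.time x.1 < 1 ∧ B₁.radius x.1 < 3 * M₁ + 1} → Topology.IsOpenEmbedding ({x | -1 < B₁.time x.1 ∧ B₁.time x.1 < 1 ∧ B₁.radius x.1 < 3 * M₁ + 1}.restrict Φ₁) → 𝒟.toSpacetime.truncDeviationCk B₁ Φ₁ k₁ (3 * M₁) 0 ≤ δ₁ → Disjoint (Φ₁ '' B₁.truncTimeSlab (3 * M₁) 0) (𝒟.metric.causalPast 𝒟.timeOrientation K₁) → |a₁| ≤ χ₁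 * M₁)) := by
  intro h₅
  exact not_collarMarginClause_of_junk 𝒟 hJ (h₅ X D hD 𝒟 hmax hCNI hW)

end Summit.FinalStateConjecture.FinalStateConjecture.Cruxes.TameCensorshipCollarMargin.ZdmSpinupWindow

end
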